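import Literature.Analysis.FluidPDE.HardSphereCollisionRecord
import Literature.MathematicalPhysics.KineticTheory.HardSphereEuler
import HarnessLib

/-!
# Route JParityClosure, crux `RateFloor`, line `Sketch`: the line's static functionals (definitions)

Route-posited objects of the line `Sketch` for the crux item stmt-AtomisticToContinuum-13080 (`RateFloor`, sub-problem
HydrodynamicLimit): the static pair functionals through which the line transfers the crux's collision functional
`K_N[χΞ]` to the ideal-gas functional `B^Ξ_r` (crux workfile `Cruxes/RateFloor/Lines/Sketch.lean`, gens 0–1).  They are
filed here, in a reviewed definitions file, so that the line's two open registered stubs `stub_noBursts` (S7a) and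
`stub_staticOpacityFloor` (S7b) — in-probability statements whose events are built from these functionals — can be
landed under `Theorems/` or promoted to statement items VERBATIM (a crux workfile is not importable there).  Pure
definitions over the library's hard-sphere prelude on the flat torus `𝕋³`; no new mathematics.

For an `n`-particle configuration `z` on `𝕋³ × ℝ³`, diameter `ε`, window length `Δ`:

* `firstContact ε Δ z p` — the first time in `(0, Δ]` at which the FREE flights of the ordered pair `p` issued from `z`
  are within `ε` (an `sInf`; junk `sInf ∅` when `p` is not would-be);
* `wouldBePairs ε Δ z` — ordered pairs of distinct particles whose free flights come within `ε` during `(0, Δ]`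
  (Boltzmann's collision cylinders read on the actual configuration); `realisedPairs ε Δ γ s ⊆ wouldBePairs ε Δ (γ s)`
  — those none of whose endpoints takes part in a collision of the curve `γ` strictly between `s` and the predicted
  contact time (`realisedPairs_subset_wouldBePairs`);
* `wouldBeSum` / `realisedSum` — the marked sums over these pairs, marks `F (time) (x̂ᵢ) (x̂ⱼ) (vᵢ) (vⱼ)` read at the
  PREDICTED datum (predicted contact time, free-flight positions there, window-start velocities);
* `lineSW` / `lineSR` — `ε/n` times the sums over the windows `(kΔ, (k+1)Δ]`, `k < ⌊τ/Δ⌋`, of the would-be / realised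
  marked sums of the window-start configurations `γ (kΔ)`: the line's static functionals `S_W ≥ S_R`;
* `multiPairs` — would-be pairs at a particle of would-be out-degree `≥ 2`; `secondaryCount ε γ s t` — ordered contact
  pairs at collision times `u ∈ (s, t]` with a member that already took part in a collision during `(s, u)`;
  `lineBursts` — their total over the windows (the line's burst count, real-valued);
* `windowLen A N = A (N+1)^{-1/3}` (gen 0) and `windowLenB A b N = A (N+1)^{-b}` (gen 1) — the window lengths.

What is deliberately NOT here: any statement about these objects (the kinematic transfer theorems are the landed files
`Theorems/JParityClosureRateFloor{RealisedDatum,MarkedTransfer,PathwiseTransfer,RealisedCap}.lean`, stated inline; the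
open stubs live in the crux workfile until proved).

References: Gallagher–Saint-Raymond–Texier 2013 §4.1 (hard-sphere trajectories, collision cylinders); elementary.
-/

noncomputable section

open scoped BigOperators Classical
open MeasureTheory Set
open Literature.Analysis.FluidPDE Literature.MathematicalPhysics.KineticTheory

namespace Summit.AtomisticToContinuum.HydrodynamicLimit.Theorems

namespace RateFloorLine

variable {n : ℕ}

/-- The first free CONTACT time of the ordered pair `p` of `z` within `(0, Δ]`: the infimum of the times
`u ∈ (0, Δ]` at which the free flights of `p.1`, `p.2` issued from `z` are within `ε` (junk value `sInf ∅` if there is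
none). [folklore] -/
def firstContact (ε Δ : ℝ) (z : Config n (Fin 3) T3) (p : Fin n × Fin n) : ℝ :=
  sInf {u : ℝ | u ∈ Set.Ioc 0 Δ ∧ ‖(Torus.geometry (Fin 3)).sepVec
    (freeFlight (Torus.geometry (Fin 3)) u z p.1).1 (freeFlight (Torus.geometry (Fin 3)) u z p.2).1‖ ≤ ε}

/-- The ordered WOULD-BE pairs of the configuration `z` for the window length `Δ`: distinct particles whose free
flights come within `ε` at some time of `(0, Δ]`. [folklore] -/
def wouldBePairs (ε Δ : ℝ) (z : Config n (Fin 3) T3) : Finset (Fin n × Fin n) :=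
  Finset.univ.filter fun p => p.1 ≠ p.2 ∧
    ∃ u ∈ Set.Ioc 0 Δ, ‖(Torus.geometry (Fin 3)).sepVec
      (freeFlight (Torus.geometry (Fin 3)) u z p.1).1 (freeFlight (Torus.geometry (Fin 3)) u z p.2).1‖ ≤ ε

/-- The REALISED would-be pairs of the window `(s, s + Δ]` along the curve `γ`: ordered would-be pairs of `γ s` none
of whose endpoints participates in a collision strictly between `s` and the pair's predicted contact time. [folklore] -/
def realisedPairs (ε Δ : ℝ) (γ : ℝ → Config n (Fin 3) T3) (s : ℝ) : Finset (Fin n × Fin n) :=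
  Finset.univ.filter fun p => p.1 ≠ p.2 ∧
    (∃ u ∈ Set.Ioc 0 Δ, ‖(Torus.geometry (Fin 3)).sepVec
      (freeFlight (Torus.geometry (Fin 3)) u (γ s) p.1).1 (freeFlight (Torus.geometry (Fin 3)) u (γ s) p.2).1‖ ≤ ε) ∧
    (∀ u ∈ Set.Ioo s (s + firstContact ε Δ (γ s) p), ¬ Participates (Torus.geometry (Fin 3)) ε (γ u) p.1) ∧
    (∀ u ∈ Set.Ioo s (s + firstContact ε Δ (γ s) p), ¬ Participates (Torus.geometry (Fin 3)) ε (γ u) p.2)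

/-- The marked sum over the would-be pairs of `z` (window starting at time `s`), each mark read at the PREDICTED datum
(predicted contact time, free-flight positions there, window-start velocities). [folklore] -/
def wouldBeSum (ε Δ : ℝ) (z : Config n (Fin 3) T3) (s : ℝ) (F : ℝ → T3 → T3 → V3 → V3 → ℝ) : ℝ :=
  ∑ p ∈ wouldBePairs ε Δ z,
    F (s + firstContact ε Δ z p) (freeFlight (Torus.geometry (Fin 3)) (firstContact ε Δ z p) z p.1).1
      (freeFlight (Torus.geometry (Fin 3)) (firstContact ε Δ z p) z p.2).1 ((z p.1).2) ((z p.2).2)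

/-- The marked sum over the realised would-be pairs of one window, marks at the predicted datum. [folklore] -/
def realisedSum (ε Δ : ℝ) (γ : ℝ → Config n (Fin 3) T3) (s : ℝ) (F : ℝ → T3 → T3 → V3 → V3 → ℝ) : ℝ :=
  ∑ p ∈ realisedPairs ε Δ γ s,
    F (s + firstContact ε Δ (γ s) p) (freeFlight (Torus.geometry (Fin 3)) (firstContact ε Δ (γ s) p) (γ s) p.1).1
      (freeFlight (Torus.geometry (Fin 3)) (firstContact ε Δ (γ s) p) (γ s) p.2).1 ((γ s p.1).2) ((γ s p.2).2)

/-- The WOULD-BE static functional `S_W`: `ε/n` times the would-be marked sums of the window-start configurations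
`γ (kΔ)`, `k < ⌊τ/Δ⌋`. [folklore] -/
def lineSW (ε Δ τ : ℝ) (γ : ℝ → Config n (Fin 3) T3) (F : ℝ → T3 → T3 → V3 → V3 → ℝ) : ℝ :=
  ε / n * ∑ k ∈ Finset.range ⌊τ / Δ⌋₊, wouldBeSum ε Δ (γ (k * Δ)) (k * Δ) F

/-- The REALISED static functional `S_R`: `ε/n` times the realised marked sums of the windows `(kΔ, (k+1)Δ]`,
`k < ⌊τ/Δ⌋`. [folklore] -/
def lineSR (ε Δ τ : ℝ) (γ : ℝ → Config n (Fin 3) T3) (F : ℝ → T3 → T3 → V3 → V3 → ℝ) : ℝ :=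
  ε / n * ∑ k ∈ Finset.range ⌊τ / Δ⌋₊, realisedSum ε Δ γ (k * Δ) F

/-- The would-be pairs at a particle of would-be out-degree `≥ 2` (either endpoint): the static part of the burst
count. [folklore] -/
def multiPairs (ε Δ : ℝ) (z : Config n (Fin 3) T3) : Finset (Fin n × Fin n) :=
  (wouldBePairs ε Δ z).filter fun p =>
    2 ≤ ((wouldBePairs ε Δ z).filter fun q => q.1 = p.1).card ∨
      2 ≤ ((wouldBePairs ε Δ z).filter fun q => q.1 = p.2).card

/-- The SECONDARY contact incidences of the window `(s, t]` along `γ`: ordered contact pairs at collision times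
`u ∈ (s, t]` one of whose members already took part in a collision during `(s, u)` (a `finsum` over the collision
times; finitely many on a hard-sphere trajectory). [folklore] -/
def secondaryCount (ε : ℝ) (γ : ℝ → Config n (Fin 3) T3) (s t : ℝ) : ℕ :=
  ∑ᶠ (u : ℝ) (_ : u ∈ collisionTimes (Torus.geometry (Fin 3)) ε γ ∩ Set.Ioc s t),
    ((contactPairs (Torus.geometry (Fin 3)) ε (γ u)).filter fun q =>
      ∃ u' ∈ Set.Ioo s u, Participates (Torus.geometry (Fin 3)) ε (γ u') q.1 ∨
        Participates (Torus.geometry (Fin 3)) ε (γ u') q.2).card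

/-- The burst count over the windows `(kΔ, (k+1)Δ]`, `k < ⌊τ/Δ⌋` (real-valued): multi-degree would-be pairs of the
window-start configuration plus secondary contact incidences of the window. [folklore] -/
def lineBursts (ε Δ τ : ℝ) (γ : ℝ → Config n (Fin 3) T3) : ℝ :=
  ∑ k ∈ Finset.range ⌊τ / Δ⌋₊,
    (((multiPairs ε Δ (γ (k * Δ))).card : ℝ) + (secondaryCount ε γ (k * Δ) (k * Δ + Δ) : ℝ))

/-- The gen-0 window length `Δ_N = A (N+1)^{-1/3}` (a fixed multiple of the mean free time at fixed reduced
density). [folklore] -/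
def windowLen (A : ℝ) (N : ℕ) : ℝ := A * ((N + 1 : ℕ) : ℝ) ^ (-(1 / 3 : ℝ))

/-- The gen-1 window length `Δ_N = A (N+1)^{-b}` (`b = 1/3`: gen 0; `b > 1/3`: a vanishing fraction of the mean free
time). [folklore] -/
def windowLenB (A b : ℝ) (N : ℕ) : ℝ := A * ((N + 1 : ℕ) : ℝ) ^ (-b)

/-- Realised pairs are would-be pairs (registered bridge stub `realisedPairs_subset_wouldBePairs` of the line `Sketch`,
crux stmt-AtomisticToContinuum-13080: the `R ⊆ W` step of the would-be transfer S10). [folklore] -/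
theorem realisedPairs_subset_wouldBePairs :
    ∀ (n : ℕ) (ε Δ : ℝ) (γ : ℝ → Config n (Fin 3) T3) (s : ℝ), realisedPairs ε Δ γ s ⊆ wouldBePairs ε Δ (γ s) := by
  intro n ε Δ γ s p hp
  simp only [realisedPairs, wouldBePairs, Finset.mem_filter, Finset.mem_univ, true_and] at hp ⊢
  exact ⟨hp.1, hp.2.1⟩

/-- Multi-degree would-be pairs are would-be pairs. [folklore] -/
theorem multiPairs_subset_wouldBePairs (ε Δ : ℝ) (z : Config n (Fin 3) T3) :
    multiPairs ε Δ z ⊆ wouldBePairs ε Δ z :=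
  Finset.filter_subset _ _

/-- `windowLenB A (1/3) = windowLen A`. [folklore] -/
theorem windowLenB_one_third (A : ℝ) (N : ℕ) : windowLenB A (1 / 3) N = windowLen A N := rfl

/-- The window lengths are positive for `A > 0`. [folklore] -/
theorem windowLenB_pos {A : ℝ} (hA : 0 < A) (b : ℝ) (N : ℕ) : 0 < windowLenB A b N :=
  mul_pos hA (Real.rpow_pos_of_pos (by positivity) _)

/-- The burst count is nonnegative. [folklore] -/
theorem lineBursts_nonneg (ε Δ τ : ℝ) (γ : ℝ → Config n (Fin 3) T3) : 0 ≤ lineBursts ε Δ τ γ :=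
  Finset.sum_nonneg fun _ _ => by positivity

end RateFloorLine

end Summit.AtomisticToContinuum.HydrodynamicLimit.Theorems

end
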